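import Summits.BirchSwinnertonDyer.BirchSwinnertonDyer.Theorems.AlignedTransportAtTwoMainConjectureOfRankZeroBSDAtTwoEisensteinRigidityIrreducible
import Mathlib.NumberTheory.Padics.RingHoms
import HarnessLib

/-!
# Route `AlignedTransportAtTwo`, crux C2 `MainConjectureOfRankZeroBSDAtTwo` (stmt-BirchSwinnertonDyer-22298):
# A ROOT-FREE IRREDUCIBILITY CRITERION AT `λ = 2` — `μ(H) = 0`, `λ(H) = 2`, `‖H(0)‖₂ = ¼`, `‖H₁‖₂ = ½ ⇒ H` irreducible in `ℤ₂⟦T⟧`;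
# hence OFF THE ROAD the `λ₂ = 2`, `a₂ = +1` seeds with `ord₂(T¹-coefficient of L₂) = 1` have `char X ∈ {(L₂), (4)}`: ONE BIT, certificate-free

HONEST FRAMING (cell `bsd-f1-sign2`, WIDTH-5 attached prover seat `bsd-line-att-p5` gen 34 on line `birth` of the lead
`bsd-line-att-p2`; `--supports` stmt-BirchSwinnertonDyer-22298, closes nothing; BSD is NOT proved by any of this; the crux C2, its
verdict «blocked-on `Rank1Residual.GreenbergMuConjectureIrreducible`» and every registered stub are untouched). THEOREMS ONLY — no
`def`, no `sorry`, nothing asserted. PRINT binders as in `…EisensteinRigidityIrreducible`: `h17`, `hGr`, `hper`, `hmod`, `hGZK` (no `h64`, no road).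

* §1 (pure `Λ`-algebra, `p = 2`) `norm_add_le_quarter_of_norm_eq_half` (`‖x‖ = ‖y‖ = ½ ⇒ ‖x + y‖ ≤ ¼`: two odd multiples of `2` sum into `4ℤ₂`);
  `isUnit_coeff_one_of_lam_eq_one` (`μ(A) = 0`, `λ(A) = 1 ⇒ A₁ ∈ ℤ₂ˣ`); ★ `irreducible_of_lam_two`: **`μ(H) = 0`, `λ(H) = 2`, `‖H₀‖₂ = ¼`, `‖H₁‖₂ = ½ ⇒ H`
  irreducible in `Λ`** — a factorisation into two non-units `A·B` forces `λ(A) = λ(B) = 1`, `‖A₀‖ = ‖B₀‖ = ½`, `A₁, B₁` units, and then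
  `H₁ = A₀B₁ + A₁B₀ ∈ 4ℤ₂`. (The quadratic distinguished polynomial `T² + 2bT + 4u` is irreducible over `ℚ₂` iff `b` is odd; Matsuno's `N = 1169`, `(T+2)²`,
  has `H₁ = 4`.)
* §2 ★★ `lambda_mu_dichotomy_of_lam_two` — `W/ℚ` globally minimal, good ordinary at `2` with `a₂ = +1`, no rational point of order `2`, `r_an = 0`, `BSD(W,2)`, `f` its
  newform at level `N_W` with `‖[0]⁺_f‖₂ = 1`, `G` an integral lift with `red G ≠ 0`, **`λ(G) = 2` and `‖G₁‖₂ = ½`** (two numeric invariants of `L₂(W,T)`, no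
  irreducibility certificate); PRINT `h17`, `hGr`, `hper`, `hGZK`: **`(λ(X), μ(X)) ∈ {(2, 0), (0, 2)}`** at every cyclotomic dual datum — `char X ∈ {(L₂), (4)}`, ONE BIT
  `λ_alg ≠ 0`; `mazurMainConjecture_two_of_lam_two_of_layerRankGEAt_one` — + ONE Mordell–Weil point of infinite order anywhere up the `2`-tower ⟹ MC₂(W).
  By this lineage's floor R61a (`λ₂ ≥ 2`, `= 2` only off the road, `χ₈(N_W) = +1`) this is the generic OFF-ROAD shape.

References: K. Kato, Astérisque 295 (2004), Thm. 17.4 [Kato2004Asterisque]; R. Greenberg, LNM 1716 (1999), §5 pp. 176–182 [GreenbergLNM1716]; K. Matsuno, IJNT 4 (2008),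
Example 2 (p. 421) [Matsuno2008]; L. Washington, GTM 83, §7.1 [Washington1997].
-/

set_option linter.dupNamespace false
set_option autoImplicit false

noncomputable section

open scoped Classical MatrixGroups ModularForm

namespace Summit.BirchSwinnertonDyer.BirchSwinnertonDyer.Theorems.AlignedTransportAtTwoEisensteinRigidityLambdaTwo

open PowerSeries CongruenceSubgroup WeierstrassCurve Literature.NumberTheory.EllipticCurves
  Literature.NumberTheory.EllipticCurves.ModularForms
  Literature.NumberTheory.EllipticCurves.Rank1Residual
  Literature.NumberTheory.EllipticCurves.Rank1Residual.Typed
  Literature.NumberTheory.EllipticCurves.Greenberg1999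
  Summit.BirchSwinnertonDyer.Rank1Residual
  Summit.BirchSwinnertonDyer.Rank1Residual.X1.MuLambda
  Summit.BirchSwinnertonDyer.Rank1Residual.X1.MuPart
  Summit.BirchSwinnertonDyer.Rank1Residual.X1.ParitySqueeze
  Summit.BirchSwinnertonDyer.Rank1Residual.X5
  Summit.BirchSwinnertonDyer.Rank1Residual.F1Sign2
  Summit.BirchSwinnertonDyer.BirchSwinnertonDyer.Theorems.Rank1ResidualX1Defs
  Summit.BirchSwinnertonDyer.BirchSwinnertonDyer.Theorems.AlignedTransportAtTwoSeed
  Summit.BirchSwinnertonDyer.BirchSwinnertonDyer.Theorems.AlignedTransportAtTwoSeedLambdaCell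
  Summit.BirchSwinnertonDyer.BirchSwinnertonDyer.Theorems.AlignedTransportAtTwoTwoFixedPoints
  Summit.BirchSwinnertonDyer.BirchSwinnertonDyer.Theorems.AlignedTransportAtTwoRoadSecondFixedPoint
  Summit.BirchSwinnertonDyer.BirchSwinnertonDyer.Theorems.AlignedTransportAtTwoEisensteinRigidity
  Summit.BirchSwinnertonDyer.BirchSwinnertonDyer.Theorems.AlignedTransportAtTwoEisensteinRigidityRoad
  Summit.BirchSwinnertonDyer.BirchSwinnertonDyer.Theorems.AlignedTransportAtTwoEisensteinRigidityIrreducible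

/-! ## §1 The criterion -/

section Algebra

/-- A non-unit of `ℤ₂` has norm `≤ ½`; in particular `‖x‖ < 1 ⇒ ‖x‖ ≤ ½`. [folklore] -/
theorem norm_le_half_of_norm_lt_one {x : ℤ_[2]} (hx : ‖x‖ < 1) : ‖x‖ ≤ (2 : ℝ)⁻¹ := by
  obtain ⟨y, rfl⟩ := (PadicInt.norm_lt_one_iff_dvd x).mp hx
  have h2 : ‖((2 : ℕ) : ℤ_[2])‖ = 2⁻¹ := by rw [PadicInt.norm_p]; norm_num
  rw [norm_mul, h2]
  calc (2 : ℝ)⁻¹ * ‖y‖ ≤ 2⁻¹ * 1 := by gcongr; exact PadicInt.norm_le_one y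
    _ = 2⁻¹ := mul_one _

/-- **Two odd multiples of `2` sum into `4ℤ₂`**: `‖x‖₂ = ‖y‖₂ = ½ ⇒ ‖x + y‖₂ ≤ ¼`. [folklore] -/
theorem norm_add_le_quarter_of_norm_eq_half {x y : ℤ_[2]} (hx : ‖x‖ = (2 : ℝ)⁻¹) (hy : ‖y‖ = (2 : ℝ)⁻¹) :
    ‖x + y‖ ≤ (4 : ℝ)⁻¹ := by
  have h2 : ‖((2 : ℕ) : ℤ_[2])‖ = 2⁻¹ := by rw [PadicInt.norm_p]; norm_num
  obtain ⟨x', rfl⟩ := (PadicInt.norm_lt_one_iff_dvd x).mp (by rw [hx]; norm_num)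
  obtain ⟨y', rfl⟩ := (PadicInt.norm_lt_one_iff_dvd y).mp (by rw [hy]; norm_num)
  rw [norm_mul, h2] at hx hy
  have hx' : ‖x'‖ = 1 := by linarith
  have hy' : ‖y'‖ = 1 := by linarith
  -- in `ZMod 2` both residues are `1`, so the residue of `x' + y'` is `0`
  have hone : ∀ z : ZMod 2, z ≠ 0 → z = 1 := by decide
  have hres : ∀ {z : ℤ_[2]}, ‖z‖ = 1 → PadicInt.toZMod z = 1 := by
    intro z hz
    apply hone
    intro h0
    have hmem : z ∈ RingHom.ker (PadicInt.toZMod : ℤ_[2] →+* ZMod 2) := h0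
    rw [PadicInt.ker_toZMod] at hmem
    exact (IsLocalRing.mem_maximalIdeal _).mp hmem (PadicInt.isUnit_iff.mpr hz)
  have hsum : x' + y' ∈ IsLocalRing.maximalIdeal ℤ_[2] := by
    rw [← PadicInt.ker_toZMod, RingHom.mem_ker, map_add, hres hx', hres hy']
    decide
  have hlt : ‖x' + y'‖ < 1 := PadicInt.not_isUnit_iff.mp ((IsLocalRing.mem_maximalIdeal _).mp hsum)
  have hle := norm_le_half_of_norm_lt_one hlt
  rw [← mul_add, norm_mul, h2]
  calc (2 : ℝ)⁻¹ * ‖x' + y'‖ ≤ 2⁻¹ * 2⁻¹ := by gcongr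
    _ = 4⁻¹ := by norm_num

/-- **`μ(A) = 0`, `λ(A) = 1 ⇒` the `T¹`-coefficient of `A` is a unit** (the reduction of `A` has order exactly `1`). [cite: Washington1997, §7.1] -/
theorem isUnit_coeff_one_of_lam_eq_one {A : PowerSeries ℤ_[2]} (hA : A ≠ 0) (hμ : mu A = 0) (hl : lam A = 1) :
    IsUnit (coeff 1 A) := by
  have hpf : pfree A = A := pfree_eq_self_of_mu_eq_zero hμ
  have hred : red A ≠ 0 := by rw [← hpf]; exact red_pfree_ne_zero hA
  have h1 : (red A).order.toNat = 1 := by rw [lam, hpf] at hl; exact hl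
  have hc : coeff 1 (red A) ≠ 0 := by
    have h := PowerSeries.coeff_order hred
    rwa [h1] at h
  rw [PowerSeries.coeff_map] at hc
  by_contra hnu
  exact hc ((IsLocalRing.residue_eq_zero_iff _).mpr ((IsLocalRing.mem_maximalIdeal _).mpr hnu))

/-- ★ **IRREDUCIBILITY AT `λ = 2`, ROOT-FREE.** `H ∈ ℤ₂⟦T⟧` with `μ(H) = 0`, `λ(H) = 2`, `‖H₀‖₂ = ¼`, `‖H₁‖₂ = ½` is irreducible in `Λ`: a factorisation `A·B` into
non-units has `λ(A) = λ(B) = 1`, `‖A₀‖ = ‖B₀‖ = ½`, unit `T¹`-coefficients, hence `H₁ = A₀B₁ + A₁B₀ ∈ 4ℤ₂`. (Its distinguished polynomial is `T² + 2bT + 4u` with `b`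
odd — irreducible over `ℚ₂`; `b` even, e.g. `(T+2)²`, is excluded by `‖H₁‖ = ½`.) [cite: Washington1997, §7.1] [cite: GreenbergLNM1716, §5 p. 176] -/
theorem irreducible_of_lam_two {H : PowerSeries ℤ_[2]} (hμ : mu H = 0) (hl : lam H = 2)
    (h0 : ‖constantCoeff H‖ = (4 : ℝ)⁻¹) (h1 : ‖coeff 1 H‖ = (2 : ℝ)⁻¹) : Irreducible H := by
  have hH0 : H ≠ 0 := by
    rintro rfl
    rw [map_zero, norm_zero] at h0
    norm_num at h0
  refine irreducible_iff.mpr ⟨fun hu => ?_, fun A B hAB => ?_⟩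
  · have h := PadicInt.isUnit_iff.mp (PowerSeries.isUnit_iff_constantCoeff.mp hu)
    rw [h0] at h
    norm_num at h
  · by_contra hne
    obtain ⟨hA, hB⟩ := not_or.mp hne
    have hA0 : A ≠ 0 := by rintro rfl; exact hH0 (by rw [hAB, zero_mul])
    have hB0 : B ≠ 0 := by rintro rfl; exact hH0 (by rw [hAB, mul_zero])
    -- `μ(A) = μ(B) = 0`
    have hμAB : mu A + mu B = 0 := by rw [← mu_mul hA0 hB0, ← hAB, hμ]
    have hμA : mu A = 0 := by omega
    have hμB : mu B = 0 := by omega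
    -- `λ(A) = λ(B) = 1`
    have hlAB : lam A + lam B = 2 := by rw [← lam_mul hA0 hB0, ← hAB, hl]
    have hlA1 : 1 ≤ lam A := by
      by_contra hlt
      exact hA ((isUnit_iff_mu_eq_zero_and_lam_eq_zero A).mpr ⟨hA0, hμA, by omega⟩)
    have hlB1 : 1 ≤ lam B := by
      by_contra hlt
      exact hB ((isUnit_iff_mu_eq_zero_and_lam_eq_zero B).mpr ⟨hB0, hμB, by omega⟩)
    have hA1 : ‖coeff 1 A‖ = 1 := PadicInt.isUnit_iff.mp (isUnit_coeff_one_of_lam_eq_one hA0 hμA (by omega))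
    have hB1 : ‖coeff 1 B‖ = 1 := PadicInt.isUnit_iff.mp (isUnit_coeff_one_of_lam_eq_one hB0 hμB (by omega))
    -- constant terms: both of norm `½`
    have hA0n : ‖constantCoeff A‖ ≤ (2 : ℝ)⁻¹ :=
      norm_le_half_of_norm_lt_one (PadicInt.not_isUnit_iff.mp (fun h => hA (PowerSeries.isUnit_iff_constantCoeff.mpr h)))
    have hB0n : ‖constantCoeff B‖ ≤ (2 : ℝ)⁻¹ :=
      norm_le_half_of_norm_lt_one (PadicInt.not_isUnit_iff.mp (fun h => hB (PowerSeries.isUnit_iff_constantCoeff.mpr h)))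
    have hprod : ‖constantCoeff A‖ * ‖constantCoeff B‖ = (4 : ℝ)⁻¹ := by rw [← norm_mul, ← map_mul, ← hAB, h0]
    have hAge : (4 : ℝ)⁻¹ ≤ ‖constantCoeff A‖ * 2⁻¹ := by
      calc (4 : ℝ)⁻¹ = ‖constantCoeff A‖ * ‖constantCoeff B‖ := hprod.symm
        _ ≤ ‖constantCoeff A‖ * 2⁻¹ := by gcongr
    have hBge : (4 : ℝ)⁻¹ ≤ 2⁻¹ * ‖constantCoeff B‖ := by
      calc (4 : ℝ)⁻¹ = ‖constantCoeff A‖ * ‖constantCoeff B‖ := hprod.symm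
        _ ≤ 2⁻¹ * ‖constantCoeff B‖ := by gcongr
    have hAe : ‖constantCoeff A‖ = (2 : ℝ)⁻¹ := by apply le_antisymm hA0n; linarith
    have hBe : ‖constantCoeff B‖ = (2 : ℝ)⁻¹ := by apply le_antisymm hB0n; linarith
    -- `H₁ = A₀B₁ + A₁B₀ ∈ 4ℤ₂`
    have hc1 : coeff 1 H = coeff 0 A * coeff 1 B + coeff 1 A * coeff 0 B := by
      rw [hAB, PowerSeries.coeff_mul, Finset.Nat.sum_antidiagonal_eq_sum_range_succ_mk]
      simp [Finset.sum_range_succ]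
    rw [PowerSeries.coeff_zero_eq_constantCoeff_apply, PowerSeries.coeff_zero_eq_constantCoeff_apply] at hc1
    have hx : ‖constantCoeff A * coeff 1 B‖ = (2 : ℝ)⁻¹ := by rw [norm_mul, hAe, hB1, mul_one]
    have hy : ‖coeff 1 A * constantCoeff B‖ = (2 : ℝ)⁻¹ := by rw [norm_mul, hA1, hBe, one_mul]
    have hle := norm_add_le_quarter_of_norm_eq_half hx hy
    rw [← hc1, h1] at hle
    norm_num at hle

end Algebra

/-! ## §2 The `λ₂ = 2`, `a₂ = +1` seeds: `char X ∈ {(L₂), (4)}` — one bit, certificate-free -/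

variable (W : WeierstrassCurve ℚ) [W.IsElliptic] [W.IsGloballyMinimal]

/-- ★★ **`λ₂ = 2`, `a₂ = +1`, `ord₂(T¹-coefficient) = 1`: `(λ(X), μ(X)) ∈ {(2, 0), (0, 2)}`.** `W/ℚ` globally minimal, good ordinary at `2` with `a₂ = +1`, no rational
point of order `2`, `r_an = 0`, `BSD(W,2)`; `f` its newform at level `N_W` with `‖[0]⁺_f‖₂ = 1`; `G` an integral lift of `L₂(f,α)` with `red G ≠ 0`, `λ(G) = 2` and
`‖G₁‖₂ = ½`; PRINT `h17`, `hGr`, `hper`, `hGZK`. Then `G` is irreducible in `Λ` (§1) and `char_Λ X ∈ {(G), (4)}` at every cyclotomic dual datum.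
[cite: Kato2004Asterisque, Thm. 17.4 (1)(2) (p. 273)] [cite: GreenbergLNM1716, Thm. 4.1 (p. 102) and §5 pp. 176, 180] -/
theorem lambda_mu_dichotomy_of_lam_two [NeZero (W.conductorNorm ℤ)] {f : CuspForm (Gamma0 (W.conductorNorm ℤ)) 2}
    (h17 : kato_divisibility_allPrimes W 2 (f := f)) (hGr : Greenberg1999.thm41_charValue_rankZero_anyPrime)
    (hper : realPeriodRat_eq_unit_mul_plusPeriod_two) (hGZK : rank_eq_analyticRank_of_analyticRank_le_one)
    (hord : IsOrdinaryAt W 2) (ht : ∀ x : ℚ, ¬ HasRationalTwoTorsionX W x) (hr : W.analyticRank = 0) (hbsd : BSDp W 2)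
    (hf : IsNewformOf W f) (ha : W.frobeniusTrace 2 = 1)
    {G : IwasawaAlgebra 2} (hG : iwasawaToPowerSeries 2 G = padicLFunction f (unitRoot W 2 : ℚ_[2]))
    (hred : red G ≠ 0) (hl : lam G = 2) (h1 : ‖coeff 1 G‖ = (2 : ℝ)⁻¹) (hsym : ‖(ratPlusSymbol f 0 : ℚ_[2])‖ = 1)
    {κ : ZpExtension ℚ 2} {γ : Field.absoluteGaloisGroup ℚ} (hκ : κ.IsCyclotomic) (hγ : κ.IsTopGenerator γ)
    (hγ' : IsCyclotomicVariable 2 γ) (D : W.SelmerDualData κ γ) :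
    Irreducible G ∧ ((D.lambda = 2 ∧ D.mu = 0) ∨ (D.lambda = 0 ∧ D.mu = 2)) := by
  have h0 : ‖constantCoeff G‖ = (4 : ℝ)⁻¹ := norm_constantCoeff_lift_eq_quarter_of_frobeniusTrace_eq_one W hord hf ha hG hsym
  have hirr : Irreducible G := irreducible_of_lam_two (mu_eq_zero_of_red_ne_zero hred) hl h0 h1
  have hGv : ‖constantCoeff G‖ = (2 : ℝ)⁻¹ ^ 2 := by rw [h0]; norm_num
  refine ⟨hirr, ?_⟩
  have h := lambda_mu_dichotomy_of_irreducible_lift W h17 hGr hper hGZK hord ht hr hbsd hf hG hred hirr hGv hκ hγ hγ' D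
  rwa [hl] at h

/-- **MC at the datum ⟺ `λ(X) ≠ 0` ⟺ `μ(X) ≠ 2`** on the `λ₂ = 2`, `a₂ = +1` seeds of `lambda_mu_dichotomy_of_lam_two`. [cite: Kato2004Asterisque, Thm. 17.4 (1)(2) (p. 273)] -/
theorem mu_eq_zero_iff_lambda_ne_zero_of_lam_two [NeZero (W.conductorNorm ℤ)] {f : CuspForm (Gamma0 (W.conductorNorm ℤ)) 2}
    (h17 : kato_divisibility_allPrimes W 2 (f := f)) (hGr : Greenberg1999.thm41_charValue_rankZero_anyPrime)
    (hper : realPeriodRat_eq_unit_mul_plusPeriod_two) (hGZK : rank_eq_analyticRank_of_analyticRank_le_one)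
    (hord : IsOrdinaryAt W 2) (ht : ∀ x : ℚ, ¬ HasRationalTwoTorsionX W x) (hr : W.analyticRank = 0) (hbsd : BSDp W 2)
    (hf : IsNewformOf W f) (ha : W.frobeniusTrace 2 = 1)
    {G : IwasawaAlgebra 2} (hG : iwasawaToPowerSeries 2 G = padicLFunction f (unitRoot W 2 : ℚ_[2]))
    (hred : red G ≠ 0) (hl : lam G = 2) (h1 : ‖coeff 1 G‖ = (2 : ℝ)⁻¹) (hsym : ‖(ratPlusSymbol f 0 : ℚ_[2])‖ = 1)
    {κ : ZpExtension ℚ 2} {γ : Field.absoluteGaloisGroup ℚ} (hκ : κ.IsCyclotomic) (hγ : κ.IsTopGenerator γ)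
    (hγ' : IsCyclotomicVariable 2 γ) (D : W.SelmerDualData κ γ) : D.mu = 0 ↔ D.lambda ≠ 0 := by
  obtain ⟨-, h⟩ := lambda_mu_dichotomy_of_lam_two W h17 hGr hper hGZK hord ht hr hbsd hf ha hG hred hl h1 hsym hκ hγ hγ' D
  rcases h with ⟨h1', h2'⟩ | ⟨h1', h2'⟩ <;> constructor <;> intro h' <;> omega

/-- ★ **DOOR: on a `λ₂ = 2`, `a₂ = +1`, `ord₂(T¹-coefficient) = 1` seed, ONE Mordell–Weil point of infinite order anywhere up the cyclotomic `ℤ₂`-tower proves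
`MazurMainConjecture W 2`.** `W` non-CM-seed hypotheses (good ordinary at `2`, no rational point of order `2`, `r_an = 0`, analytic `μ₂ = 0` on the even branch,
`BSD(W,2)`), `a₂ = +1`, and for the conductor-level newform(s): `‖[0]⁺_f‖₂ = 1`, `λ(G) = 2`, `‖G₁‖₂ = ½` for the integral lift(s) `G`; PRINT `h17`, `hGr`, `hper`, `hmod`,
`hGZK`; certificate `Iwasawa.LayerRankGEAt W 2 k 1`. [cite: GreenbergLNM1716, Thm. 1.9 (PDF p. 63)] [cite: Kato2004Asterisque, Thm. 17.4 (1)(2) (p. 273)] -/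
theorem mazurMainConjecture_two_of_lam_two_of_layerRankGEAt_one
    (h17 : ∀ [NeZero (W.conductorNorm ℤ)] (f : CuspForm (Gamma0 (W.conductorNorm ℤ)) 2),
      kato_divisibility_allPrimes W 2 (f := f))
    (hGr : Greenberg1999.thm41_charValue_rankZero_anyPrime) (hper : realPeriodRat_eq_unit_mul_plusPeriod_two)
    (hmod : nonempty_modularParametrizationData) (hGZK : rank_eq_analyticRank_of_analyticRank_le_one) (hord : IsOrdinaryAt W 2)
    (ht : ∀ x : ℚ, ¬ HasRationalTwoTorsionX W x) (hr : W.analyticRank = 0)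
    (hμan : ∀ ⦃N : ℕ⦄ [NeZero N] (f : CuspForm (Gamma0 N) 2), IsNewformOf W f →
      ∀ G : IwasawaAlgebra 2, IsEvenBranchLiftAtTwo W f G → red G ≠ 0)
    (hbsd : BSDp W 2) (ha : W.frobeniusTrace 2 = 1)
    (hcert : ∀ [NeZero (W.conductorNorm ℤ)] (f : CuspForm (Gamma0 (W.conductorNorm ℤ)) 2), IsNewformOf W f →
      ‖(ratPlusSymbol f 0 : ℚ_[2])‖ = 1 ∧ ∀ G : IwasawaAlgebra 2, iwasawaToPowerSeries 2 G = padicLFunction f (unitRoot W 2 : ℚ_[2]) →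
        lam G = 2 ∧ ‖coeff 1 G‖ = (2 : ℝ)⁻¹)
    {k : ℕ} (hrk : Iwasawa.LayerRankGEAt W 2 k 1) : MazurMainConjecture W 2 := by
  refine mazurMainConjecture_two_of_irreducible_lift_of_layerRankGEAt_one W h17 hGr hper hmod hGZK hord ht hr hμan hbsd ?_ hrk
  intro _ f hf G hG
  obtain ⟨hsym, hG'⟩ := hcert f hf
  obtain ⟨hl, h1⟩ := hG' G hG
  have hred : red G ≠ 0 := hμan f hf G (Or.inl ⟨hord, hG⟩)
  exact irreducible_of_lam_two (mu_eq_zero_of_red_ne_zero hred) hl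
    (norm_constantCoeff_lift_eq_quarter_of_frobeniusTrace_eq_one W hord hf ha hG hsym) h1


end Summit.BirchSwinnertonDyer.BirchSwinnertonDyer.Theorems.AlignedTransportAtTwoEisensteinRigidityLambdaTwo

end
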